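import Mathlib
import Summits.Ventures.PercRepro2.A3WithinCondExp

/-!
# Conditional covariance given a sub-σ-algebra: the law of total covariance (blind cell PercRepro2,
typer-1 g17 draft, filed by typer-1 g18 on the lead's word; part IV-d — Mathlib-level generality,
nothing about percolation)

Mathlib has the conditional variance `ProbabilityTheory.condVar` (`Var[X; μ | m] =
μ[(X − μ[X | m]) ^ 2 | m]`, `Probability/CondVar.lean`) and the law of total variance
`integral_condVar_add_variance_condExp`, but no conditional covariance.  Part IV-a defined
`condCovSigma m X Y μ = μ[(X − μ[X | m]) (Y − μ[Y | m]) | m]` in the same pattern; this file gives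
its Mathlib-level API on an arbitrary measure space:

* `condCovSigma_self`: `condCovSigma m X X μ = Var[X; μ | m]`; `condCovSigma_comm`;
  `condCovSigma_congr_ae`;
* `condCovSigma_ae_eq_condExp_mul_sub_mul_condExp`: for `X, Y ∈ L²` on a finite measure,
  `Cov(X, Y | m) =ᵐ μ[X Y | m] − μ[X | m] μ[Y | m]`;
* **`integral_condCovSigma_add_covariance_condExp`** (**law of total covariance**): on a
  probability space, for `m ≤ m₀` and `X, Y ∈ L²`,
  `μ[Cov(X, Y | m)] + cov[μ[X | m], μ[Y | m]; μ] = cov[X, Y; μ]`;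
* `covariance_eq_integral_condCovSigma_add_covariance_condExp'`: the cell's finite version of part
  IV-b re-derived from the general law (for `P(A) ≠ 0`) — the two proofs agree.

A library line: no percolation content beyond the cross-check.
-/

namespace Summit.Ventures.PercRepro2

open MeasureTheory ProbabilityTheory MeasureBridge

namespace CovForm

namespace A3Means

section General

variable {Ω : Type*} {m₀ m : MeasurableSpace Ω} {μ : Measure[m₀] Ω} {X X' Y Y' : Ω → ℝ}

/-- The conditional covariance of `X` with itself is the conditional variance. -/
lemma condCovSigma_self (m : MeasurableSpace Ω) (X : Ω → ℝ) (μ : Measure[m₀] Ω) :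
    condCovSigma m X X μ = condVar m X μ := by
  unfold condCovSigma condVar
  congr 1
  funext ω
  simp only [Pi.pow_apply, Pi.sub_apply]
  ring

/-- The conditional covariance is symmetric. -/
lemma condCovSigma_comm (m : MeasurableSpace Ω) (X Y : Ω → ℝ) (μ : Measure[m₀] Ω) :
    condCovSigma m X Y μ = condCovSigma m Y X μ := by
  unfold condCovSigma
  congr 1
  funext ω
  ring

/-- The conditional covariance only depends on the a.e.-classes of its arguments. -/
lemma condCovSigma_congr_ae (hX : X =ᵐ[μ] X') (hY : Y =ᵐ[μ] Y') :
    condCovSigma m X Y μ =ᵐ[μ] condCovSigma m X' Y' μ := by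
  unfold condCovSigma
  refine condExp_congr_ae ?_
  filter_upwards [hX, hY, condExp_congr_ae (m := m) hX, condExp_congr_ae (m := m) hY]
    with ω h1 h2 h3 h4
  simp only [h1, h2, h3, h4]

/-- `Cov(X, Y | m) =ᵐ μ[X Y | m] − μ[X | m] μ[Y | m]` for square-integrable `X, Y` on a finite
measure (the covariance companion of `condVar_ae_eq_condExp_sq_sub_sq_condExp`). -/
lemma condCovSigma_ae_eq_condExp_mul_sub_mul_condExp (hm : m ≤ m₀) [IsFiniteMeasure μ]
    (hX : MemLp X 2 μ) (hY : MemLp Y 2 μ) :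
    condCovSigma m X Y μ =ᵐ[μ] μ[X * Y | m] - μ[X | m] * μ[Y | m] := by
  have hXY : Integrable (X * Y) μ := hX.integrable_mul hY
  have hXc : Integrable (X * μ[Y | m]) μ := hX.integrable_mul (hY.condExp one_le_two)
  have hYc : Integrable (μ[X | m] * Y) μ := (hX.condExp one_le_two).integrable_mul hY
  have hcc : Integrable (μ[X | m] * μ[Y | m]) μ :=
    (hX.condExp one_le_two).integrable_mul (hY.condExp one_le_two)
  have heq : (fun ω => (X ω - (μ[X | m]) ω) * (Y ω - (μ[Y | m]) ω)) =
      X * Y - X * μ[Y | m] - μ[X | m] * Y + μ[X | m] * μ[Y | m] := by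
    funext ω
    simp only [Pi.add_apply, Pi.sub_apply, Pi.mul_apply]
    ring
  unfold condCovSigma
  rw [heq]
  have hconst : μ[μ[X | m] * μ[Y | m] | m] = μ[X | m] * μ[Y | m] :=
    condExp_of_stronglyMeasurable hm (stronglyMeasurable_condExp.mul stronglyMeasurable_condExp) hcc
  filter_upwards [condExp_add ((hXY.sub hXc).sub hYc) hcc m, condExp_sub (hXY.sub hXc) hYc m,
    condExp_sub hXY hXc m,
    condExp_mul_of_stronglyMeasurable_right stronglyMeasurable_condExp hXc (hX.integrable one_le_two),
    condExp_mul_of_stronglyMeasurable_left stronglyMeasurable_condExp hYc (hY.integrable one_le_two)]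
    with ω h0 h1 h2 h3 h4
  simp only [Pi.add_apply, Pi.sub_apply, Pi.mul_apply] at h0 h1 h2 h3 h4 ⊢
  rw [h0, h1, h2, h3, h4, hconst]
  simp only [Pi.mul_apply]
  ring

/-- **Law of total covariance**: on a probability space, for `m ≤ m₀` and square-integrable
`X, Y`, `μ[Cov(X, Y | m)] + cov[μ[X | m], μ[Y | m]; μ] = cov[X, Y; μ]` (the covariance companion
of `integral_condVar_add_variance_condExp`). -/
theorem integral_condCovSigma_add_covariance_condExp (hm : m ≤ m₀) [IsProbabilityMeasure μ]
    (hX : MemLp X 2 μ) (hY : MemLp Y 2 μ) :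
    (∫ ω, condCovSigma m X Y μ ω ∂μ) + cov[μ[X | m], μ[Y | m]; μ] = cov[X, Y; μ] := by
  have hcc : Integrable (μ[X | m] * μ[Y | m]) μ :=
    (hX.condExp one_le_two).integrable_mul (hY.condExp one_le_two)
  calc (∫ ω, condCovSigma m X Y μ ω ∂μ) + cov[μ[X | m], μ[Y | m]; μ]
      = (∫ ω, (μ[X * Y | m] - μ[X | m] * μ[Y | m] : Ω → ℝ) ω ∂μ) +
          ((∫ ω, (μ[X | m] * μ[Y | m]) ω ∂μ) -
            (∫ ω, (μ[X | m]) ω ∂μ) * (∫ ω, (μ[Y | m]) ω ∂μ)) := by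
        congr 1
        · exact integral_congr_ae (condCovSigma_ae_eq_condExp_mul_sub_mul_condExp hm hX hY)
        · exact covariance_eq_sub (hX.condExp one_le_two) (hY.condExp one_le_two)
    _ = (∫ ω, (X * Y) ω ∂μ) - (∫ ω, (μ[X | m] * μ[Y | m]) ω ∂μ) +
          ((∫ ω, (μ[X | m] * μ[Y | m]) ω ∂μ) - (∫ ω, X ω ∂μ) * (∫ ω, Y ω ∂μ)) := by
        rw [integral_sub' integrable_condExp hcc, integral_condExp hm, integral_condExp hm,
          integral_condExp hm]
    _ = cov[X, Y; μ] := by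
        rw [covariance_eq_sub hX hY]
        ring

end General

/-! ## The cell's finite version as a special case -/

section Finite

variable {V : Type*} {E : Type*} [Fintype V] [DecidableEq V] [Fintype E] [DecidableEq E]

omit [DecidableEq V] in
/-- The law of total covariance on the conditioned product measure given `σ(C(a₃))` — part IV-b's
`covariance_eq_integral_condCovSigma_add_covariance_condExp` for `P(A) ≠ 0` — re-derived from the
general law (every function on the finite configuration space is in `L²`). -/
theorem covariance_eq_integral_condCovSigma_add_covariance_condExp' (p : E → ℝ) (hp : IsProbVec p)
    (ends : E → Sym2 V) (a₃ : V) {A : Set (Config E)} (hA : prob p A ≠ 0) (f g : Config E → ℝ) :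
    cov[f, g; (percMeasureOf p hp)[|A]] =
      (∫ ω, condCovSigma (clusterSigma ends a₃) f g ((percMeasureOf p hp)[|A]) ω
        ∂((percMeasureOf p hp)[|A])) +
      cov[((percMeasureOf p hp)[|A])[f | clusterSigma ends a₃],
        ((percMeasureOf p hp)[|A])[g | clusterSigma ends a₃]; (percMeasureOf p hp)[|A]] := by
  haveI := cond_percMeasureOf_isProbabilityMeasure p hp hA
  exact (integral_condCovSigma_add_covariance_condExp (clusterSigma_le ends a₃)
    MemLp.of_discrete MemLp.of_discrete).symm

end Finite

end A3Means

end CovForm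

end Summit.Ventures.PercRepro2
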